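import Summits.ValiantsHypothesis.ValiantsHypothesis.Theorems.LacunarySymmetroidMatrixDescartesPivotRankOneOneThreeKillSevenOdd
import Summits.ValiantsHypothesis.ValiantsHypothesis.Theorems.LacunarySymmetroidMatrixDescartesPivotRankOneOneThreeKillSevenClose
import Summits.ValiantsHypothesis.ValiantsHypothesis.Theorems.LacunarySymmetroidMatrixDescartesPivotRankOneOneThreeKillSevenFar

/-!
# `MatrixDescartes` census — rank-one `(2,4)₁`, ONE below / THREE above, chamber (C): `Z₊ ≤ 7` BY PARITY under the kill-seven conditions
# ((T₁₂) of `…OneThreeKillSeven`, (T₀₂) of `…KillSevenClose`, (T₁₃) of `…KillSevenFar`)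

HONEST FRAMING.  Object-search cell `pub-symmetroid`, seat `val-sym-mdr-p1` (generation 26); helper file `--supports` the crux item
stmt-ValiantsHypothesis-18050 (`Theses.LacunarySymmetroid.MatrixDescartes`, OPEN, on HOLD) with NO closure claim.  Chamber (C) of the split
`d₀ < e < d₁ < d₂ < d₃` (Descartes-with-parity `9`; `≤ 7` outside (C) in the tree).  The generation-13/14 WEIGHT-FREE kill-seven theorems
(`…PivotRankOneOneThreeKillSeven{,Close,Far,S}`: keep four degrees, kill seven, the surviving four-nomial has at most one positive root) give
`≤ 8` DISTINCT roots.  Companion of `…OneThreeKillSevenOdd` (terminal lemma with multiplicity there).  THIS FILE repeats their kill bookkeeping VERBATIM with the kills counted WITH MULTIPLICITY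
(`…PivotKillMultiplicity.countP_posRoots_le_kills`) and the four-nomial terminal counted with multiplicity
(`countP_posRoots_fourNomial_le_one`: the unique positive root is SIMPLE), so `pos ≤ 8` with multiplicity; Descartes' parity
(`…OneThreeKillEightOdd.elevenNomial_oneThree_odd`: letter `0` core and letters `2, 3` not parallel ⇒ odd count) then gives **`Z₊ ≤ 7`** —
the SEVEN object's value — under each condition, in real-parameter and matrix form.  The certificate-free part of chamber (C) stays OPEN;
no covering theorem and no register move is claimed.  Nothing here bears on `MatrixDescartes` in its window, on `DoorA26` / `DoorA34`,
registers / credences, or `VP ≠ VNP`.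

[folklore] Tree kill engine with multiplicity; root multiplicity vs. derivative (`Polynomial.derivative_rootMultiplicity_of_root`);
Descartes' parity [cite: BasuPollackRoy2006, Thm. 2.33] through the tree.  No definitions, no named facts.
-/

-- `Summit.ValiantsHypothesis.ValiantsHypothesis.…` repeats a component by the D-0017 layout
-- (single-conjunct summit), which the `dupNamespace` linter flags; the name is mandated.
set_option linter.dupNamespace false

namespace Summit.ValiantsHypothesis.ValiantsHypothesis.Theorems.LacunarySymmetroidMatrixDescartes.Pivot.TwoDirections.BlockLaw

open Polynomial Matrix Finset
open scoped BigOperators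
open Summit.ValiantsHypothesis.ValiantsHypothesis.Theorems.LacunarySymmetroidMatrixDescartes.Pivot.KillMult
  (countP_posRoots_le_kills odd_countP_posRoots card_posRoots_le_pred_of_odd)
open Summit.ValiantsHypothesis.ValiantsHypothesis.Theorems.LacunarySymmetroidMatrixDescartes.SecularRolle (mul_natCast_mul_pow_pred)

/-! ## 1. (T₁₂), (T₀₂), (T₁₃) -/

/-- **T12: `Z₊ ≤ 7`.**  As the tree's `elevenNomial_oneThree_T12_le_eight` (same exponent hypotheses and kill condition, coefficient data otherwise arbitrary) plus the
sign hypotheses that make the count odd (letter `0` core: `m₀ < 0`; letters `2, 3` not parallel: `D₂₃ > 0`; positive weights): the kills counted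
WITH multiplicity give `pos ≤ 8` with multiplicity, and parity gives `7`. -/
theorem elevenNomial_oneThree_T12_le_seven (e d₀ d₁ d₂ d₃ : ℕ) (h0e : d₀ < e) (he1 : e < d₁) (h12 : d₁ < d₂) (h23 : d₂ < d₃)
    (hC3 : d₀ + d₂ < e + d₁) (hC4 : e + d₁ < d₀ + d₃) (hC5 : d₀ + d₃ < e + d₂) (hC6 : d₁ + d₂ < e + d₃)
    (dJ m₀ m₁ m₂ m₃ w₀ w₁ w₂ w₃ D01 D02 D03 D12 D13 D23 : ℝ) (hw₁ : 0 < w₁) (hw₂ : 0 < w₂) (hm₁ : m₁ < 0) (hD12 : 0 < D12) (hw₀ : 0 < w₀) (hw₃ : 0 < w₃) (hm₀ : m₀ < 0) (hD23 : 0 < D23)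
    (hS : m₁ * m₂
        * (((d₁ : ℝ) - d₀) * ((d₃ : ℝ) - d₁) * ((e : ℝ) - d₀) * ((e : ℝ) + d₁ - d₀ - d₂) * ((d₀ : ℝ) + d₃ - e - d₁) * ((d₃ : ℝ) - e) * ((d₂ : ℝ) + d₃ - e - d₁))
        * (((d₂ : ℝ) - d₀) * ((d₃ : ℝ) - d₂) * ((e : ℝ) + d₂ - d₀ - d₁) * ((e : ℝ) - d₀) * ((e : ℝ) + d₂ - d₀ - d₃) * ((d₁ : ℝ) + d₃ - e - d₂) * ((d₃ : ℝ) - e))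
        ≤ (-dJ) * D12
        * (((e : ℝ) - d₀) * ((d₃ : ℝ) - e) * ((2 : ℝ) * e - d₀ - d₁) * ((d₀ : ℝ) + d₂ - 2 * e) * ((d₀ : ℝ) + d₃ - 2 * e) * ((d₁ : ℝ) + d₃ - 2 * e) * ((d₂ : ℝ) + d₃ - 2 * e))
        * (((d₁ : ℝ) + d₂ - e - d₀) * ((e : ℝ) + d₃ - d₁ - d₂) * ((d₂ : ℝ) - d₀) * ((d₁ : ℝ) - d₀) * ((d₁ : ℝ) + d₂ - d₀ - d₃) * ((d₃ : ℝ) - d₂) * ((d₃ : ℝ) - d₁))) :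
    ((∑ i : Fin 11, Polynomial.C ((![dJ, w₀ * m₀, w₁ * m₁, w₂ * m₂, w₃ * m₃, w₀ * w₁ * D01, w₀ * w₂ * D02, w₀ * w₃ * D03, w₁ * w₂ * D12, w₁ * w₃ * D13, w₂ * w₃ * D23] : Fin 11 → ℝ) i) * X ^ ((![2 * e, e + d₀, e + d₁, e + d₂, e + d₃, d₀ + d₁, d₀ + d₂, d₀ + d₃, d₁ + d₂, d₁ + d₃, d₂ + d₃] : Fin 11 → ℕ) i)).roots.toFinset.filter (fun t => 0 < t)).card ≤ 7 := by
  classical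
  have h8 : (∑ i : Fin 11, Polynomial.C ((![dJ, w₀ * m₀, w₁ * m₁, w₂ * m₂, w₃ * m₃, w₀ * w₁ * D01, w₀ * w₂ * D02, w₀ * w₃ * D03, w₁ * w₂ * D12, w₁ * w₃ * D13, w₂ * w₃ * D23] : Fin 11 → ℝ) i) * X ^ ((![2 * e, e + d₀, e + d₁, e + d₂, e + d₃, d₀ + d₁, d₀ + d₂, d₀ + d₃, d₁ + d₂, d₁ + d₃, d₂ + d₃] : Fin 11 → ℕ) i)).roots.countP (fun x => 0 < x) ≤ 8 := by
    have h0e' : (d₀ : ℝ) < e := by exact_mod_cast h0e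
    have he1' : (e : ℝ) < d₁ := by exact_mod_cast he1
    have h12' : (d₁ : ℝ) < d₂ := by exact_mod_cast h12
    have h23' : (d₂ : ℝ) < d₃ := by exact_mod_cast h23
    have hC3' : (d₀ : ℝ) + d₂ < e + d₁ := by exact_mod_cast hC3
    have hC4' : (e : ℝ) + d₁ < d₀ + d₃ := by exact_mod_cast hC4
    have hC5' : (d₀ : ℝ) + d₃ < e + d₂ := by exact_mod_cast hC5
    have hC6' : (d₁ : ℝ) + d₂ < e + d₃ := by exact_mod_cast hC6
    -- the four distance products (positive atoms)
    obtain ⟨PA, hPA⟩ : ∃ x : ℝ, x = ((e : ℝ) - d₀) * ((d₃ : ℝ) - e) * ((2 : ℝ) * e - d₀ - d₁) * ((d₀ : ℝ) + d₂ - 2 * e) * ((d₀ : ℝ) + d₃ - 2 * e) * ((d₁ : ℝ) + d₃ - 2 * e) * ((d₂ : ℝ) + d₃ - 2 * e) := ⟨_, rfl⟩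
    obtain ⟨PB, hPB⟩ : ∃ x : ℝ, x = ((d₁ : ℝ) - d₀) * ((d₃ : ℝ) - d₁) * ((e : ℝ) - d₀) * ((e : ℝ) + d₁ - d₀ - d₂) * ((d₀ : ℝ) + d₃ - e - d₁) * ((d₃ : ℝ) - e) * ((d₂ : ℝ) + d₃ - e - d₁) := ⟨_, rfl⟩
    obtain ⟨PC, hPC⟩ : ∃ x : ℝ, x = ((d₂ : ℝ) - d₀) * ((d₃ : ℝ) - d₂) * ((e : ℝ) + d₂ - d₀ - d₁) * ((e : ℝ) - d₀) * ((e : ℝ) + d₂ - d₀ - d₃) * ((d₁ : ℝ) + d₃ - e - d₂) * ((d₃ : ℝ) - e) := ⟨_, rfl⟩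
    obtain ⟨PD, hPD⟩ : ∃ x : ℝ, x = ((d₁ : ℝ) + d₂ - e - d₀) * ((e : ℝ) + d₃ - d₁ - d₂) * ((d₂ : ℝ) - d₀) * ((d₁ : ℝ) - d₀) * ((d₁ : ℝ) + d₂ - d₀ - d₃) * ((d₃ : ℝ) - d₂) * ((d₃ : ℝ) - d₁) := ⟨_, rfl⟩
    have hS' : m₁ * m₂ * PB * PC ≤ (-dJ) * D12 * PA * PD := by rw [hPA, hPB, hPC, hPD]; exact hS
    clear hS
    have hPBp : 0 < PB := by
      rw [hPB]
      have f1 : 0 < ((d₁ : ℝ) - d₀) := by linarith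
      have f2 : 0 < ((d₃ : ℝ) - d₁) := by linarith
      have f3 : 0 < ((e : ℝ) - d₀) := by linarith
      have f4 : 0 < ((e : ℝ) + d₁ - d₀ - d₂) := by linarith
      have f5 : 0 < ((d₀ : ℝ) + d₃ - e - d₁) := by linarith
      have f6 : 0 < ((d₃ : ℝ) - e) := by linarith
      have f7 : 0 < ((d₂ : ℝ) + d₃ - e - d₁) := by linarith
      exact mul_pos (mul_pos (mul_pos (mul_pos (mul_pos (mul_pos f1 f2) f3) f4) f5) f6) f7
    have hPDp : 0 < PD := by
      rw [hPD]
      have f1 : 0 < ((d₁ : ℝ) + d₂ - e - d₀) := by linarith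
      have f2 : 0 < ((e : ℝ) + d₃ - d₁ - d₂) := by linarith
      have f3 : 0 < ((d₂ : ℝ) - d₀) := by linarith
      have f4 : 0 < ((d₁ : ℝ) - d₀) := by linarith
      have f5 : 0 < ((d₁ : ℝ) + d₂ - d₀ - d₃) := by linarith
      have f6 : 0 < ((d₃ : ℝ) - d₂) := by linarith
      have f7 : 0 < ((d₃ : ℝ) - d₁) := by linarith
      exact mul_pos (mul_pos (mul_pos (mul_pos (mul_pos (mul_pos f1 f2) f3) f4) f5) f6) f7
    -- the four surviving coefficients
    obtain ⟨A, hA⟩ : ∃ x : ℝ, x = (-dJ) * PA := ⟨_, rfl⟩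
    obtain ⟨B, hB⟩ : ∃ x : ℝ, x = w₁ * (-m₁) * PB := ⟨_, rfl⟩
    obtain ⟨C, hC⟩ : ∃ x : ℝ, x = w₂ * (-m₂) * PC := ⟨_, rfl⟩
    obtain ⟨D, hD⟩ : ∃ x : ℝ, x = w₁ * w₂ * D12 * PD := ⟨_, rfl⟩
    have hBp : 0 < B := by rw [hB]; exact mul_pos (mul_pos hw₁ (by linarith)) hPBp
    have hDp : 0 < D := by rw [hD]; exact mul_pos (mul_pos (mul_pos hw₁ hw₂) hD12) hPDp
    have hBC : B * C ≤ A * D := by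
      have e1 : B * C = (w₁ * w₂) * (m₁ * m₂ * PB * PC) := by rw [hB, hC]; ring
      have e2 : A * D = (w₁ * w₂) * ((-dJ) * D12 * PA * PD) := by rw [hA, hD]; ring
      rw [e1, e2]
      exact mul_le_mul_of_nonneg_left hS' (mul_pos hw₁ hw₂).le
    -- seven kills
    have hkills := countP_posRoots_le_kills (Finset.univ : Finset (Fin 11)) (![2 * e, e + d₀, e + d₁, e + d₂, e + d₃, d₀ + d₁, d₀ + d₂, d₀ + d₃, d₁ + d₂, d₁ + d₃, d₂ + d₃] : Fin 11 → ℕ) [e + d₀, e + d₃, d₀ + d₁, d₀ + d₂, d₀ + d₃, d₁ + d₃, d₂ + d₃] (![dJ, w₀ * m₀, w₁ * m₁, w₂ * m₂, w₃ * m₃, w₀ * w₁ * D01, w₀ * w₂ * D02, w₀ * w₃ * D03, w₁ * w₂ * D12, w₁ * w₃ * D13, w₂ * w₃ * D23] : Fin 11 → ℝ)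
    have hfour : (∑ i ∈ (Finset.univ : Finset (Fin 11)), Polynomial.C ((![dJ, w₀ * m₀, w₁ * m₁, w₂ * m₂, w₃ * m₃, w₀ * w₁ * D01, w₀ * w₂ * D02, w₀ * w₃ * D03, w₁ * w₂ * D12, w₁ * w₃ * D13, w₂ * w₃ * D23] : Fin 11 → ℝ) i
            * (([e + d₀, e + d₃, d₀ + d₁, d₀ + d₂, d₀ + d₃, d₁ + d₃, d₂ + d₃]).map (fun ρ : ℕ => (((((![2 * e, e + d₀, e + d₁, e + d₂, e + d₃, d₀ + d₁, d₀ + d₂, d₀ + d₃, d₁ + d₂, d₁ + d₃, d₂ + d₃] : Fin 11 → ℕ)) i : ℕ) : ℝ) - (ρ : ℝ)))).prod) * X ^ ((![2 * e, e + d₀, e + d₁, e + d₂, e + d₃, d₀ + d₁, d₀ + d₂, d₀ + d₃, d₁ + d₂, d₁ + d₃, d₂ + d₃] : Fin 11 → ℕ) i))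
        = (Polynomial.C A * X ^ (2 * e) - Polynomial.C B * X ^ (2 * e + (d₁ - e))
            + Polynomial.C C * X ^ (2 * e + (d₂ - e)) - Polynomial.C D * X ^ (2 * e + (d₁ - e) + (d₂ - e))) := by
      have e3 : 2 * e + (d₁ - e) + (d₂ - e) = d₁ + d₂ := by omega
      have e1 : 2 * e + (d₁ - e) = e + d₁ := by omega
      have e2 : 2 * e + (d₂ - e) = e + d₂ := by omega
      rw [e3, e1, e2]
      have hcoef : ∀ i : Fin 11, (![dJ, w₀ * m₀, w₁ * m₁, w₂ * m₂, w₃ * m₃, w₀ * w₁ * D01, w₀ * w₂ * D02, w₀ * w₃ * D03, w₁ * w₂ * D12, w₁ * w₃ * D13, w₂ * w₃ * D23] : Fin 11 → ℝ) i * (([e + d₀, e + d₃, d₀ + d₁, d₀ + d₂, d₀ + d₃, d₁ + d₃, d₂ + d₃]).map (fun ρ : ℕ => (((((![2 * e, e + d₀, e + d₁, e + d₂, e + d₃, d₀ + d₁, d₀ + d₂, d₀ + d₃, d₁ + d₂, d₁ + d₃, d₂ + d₃] : Fin 11 → ℕ)) i : ℕ) : ℝ) - (ρ : ℝ)))).p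rod
          = (![A, 0, -B, C, 0, 0, 0, 0, -D, 0, 0] : Fin 11 → ℝ) i := by
        intro i
        fin_cases i <;>
          simp only [Fin.zero_eta, Fin.mk_one, Fin.isValue, Matrix.cons_val_zero, Matrix.cons_val_one,
            List.map_cons, List.map_nil, List.prod_cons, List.prod_nil, hA, hB, hC, hD, hPA, hPB, hPC, hPD] <;>
          push_cast <;> ring
      rw [Finset.sum_congr rfl (fun i _ => by rw [hcoef i])]
      simp only [Fin.sum_univ_succ, Fin.sum_univ_zero, Matrix.cons_val_zero, Matrix.cons_val_succ, map_zero, zero_mul,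
        zero_add, add_zero, Polynomial.C_neg]
      ring
    rw [hfour] at hkills
    have hone := countP_posRoots_fourNomial_le_one A B C D hBp hDp hBC (2 * e) (d₁ - e) (d₂ - e) (by omega)
    simp only [List.length_cons, List.length_nil] at hkills
    omega
  have hodd := elevenNomial_oneThree_odd e d₀ d₁ d₂ d₃ h0e he1 h12 h23 dJ m₀ m₁ m₂ m₃ w₀ w₁ w₂ w₃ D01 D02 D03 D12 D13 D23
    (mul_neg_of_pos_of_neg hw₀ hm₀) (mul_pos (mul_pos hw₂ hw₃) hD23)
  have h7 := card_posRoots_le_pred_of_odd _ 4 hodd (by omega)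
  omega

/-- **Matrix form: `Z₊ ≤ 7`** (as the tree's `oneThree_rankOne_posRoots_le_eight_of_T12`, plus letter `0` core, letters `2, 3` not parallel, positive weights). -/
theorem oneThree_rankOne_posRoots_le_seven_of_T12 (e d₀ d₁ d₂ d₃ : ℕ) (h0e : d₀ < e) (he1 : e < d₁) (h12 : d₁ < d₂) (h23 : d₂ < d₃)
    (hC3 : d₀ + d₂ < e + d₁) (hC4 : e + d₁ < d₀ + d₃) (hC5 : d₀ + d₃ < e + d₂) (hC6 : d₁ + d₂ < e + d₃)
    (J : Matrix (Fin 2) (Fin 2) ℝ) (v₀ v₁ v₂ v₃ : Fin 2 → ℝ) (w₀ w₁ w₂ w₃ : ℝ) (hw₁ : 0 < w₁) (hw₂ : 0 < w₂) (hm₁ : (J 0 0 * v₁ 1 ^ 2 + J 1 1 * v₁ 0 ^ 2 - (J 0 1 + J 1 0) * (v₁ 0 * v₁ 1)) < 0) (hv12 : v₁ 0 * v₂ 1 - v₁ 1 * v₂ 0 ≠ 0)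
    (hw₀ : 0 < w₀) (hw₃ : 0 < w₃) (hm₀ : (J 0 0 * v₀ 1 ^ 2 + J 1 1 * v₀ 0 ^ 2 - (J 0 1 + J 1 0) * (v₀ 0 * v₀ 1)) < 0) (hD23 : 0 < (v₂ 0 * v₃ 1 - v₂ 1 * v₃ 0) ^ 2)
    (hS : (J 0 0 * v₁ 1 ^ 2 + J 1 1 * v₁ 0 ^ 2 - (J 0 1 + J 1 0) * (v₁ 0 * v₁ 1)) * (J 0 0 * v₂ 1 ^ 2 + J 1 1 * v₂ 0 ^ 2 - (J 0 1 + J 1 0) * (v₂ 0 * v₂ 1))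
        * (((d₁ : ℝ) - d₀) * ((d₃ : ℝ) - d₁) * ((e : ℝ) - d₀) * ((e : ℝ) + d₁ - d₀ - d₂) * ((d₀ : ℝ) + d₃ - e - d₁) * ((d₃ : ℝ) - e) * ((d₂ : ℝ) + d₃ - e - d₁))
        * (((d₂ : ℝ) - d₀) * ((d₃ : ℝ) - d₂) * ((e : ℝ) + d₂ - d₀ - d₁) * ((e : ℝ) - d₀) * ((e : ℝ) + d₂ - d₀ - d₃) * ((d₁ : ℝ) + d₃ - e - d₂) * ((d₃ : ℝ) - e))
        ≤ (-J.det) * ((v₁ 0 * v₂ 1 - v₁ 1 * v₂ 0) ^ 2)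
        * (((e : ℝ) - d₀) * ((d₃ : ℝ) - e) * ((2 : ℝ) * e - d₀ - d₁) * ((d₀ : ℝ) + d₂ - 2 * e) * ((d₀ : ℝ) + d₃ - 2 * e) * ((d₁ : ℝ) + d₃ - 2 * e) * ((d₂ : ℝ) + d₃ - 2 * e))
        * (((d₁ : ℝ) + d₂ - e - d₀) * ((e : ℝ) + d₃ - d₁ - d₂) * ((d₂ : ℝ) - d₀) * ((d₁ : ℝ) - d₀) * ((d₁ : ℝ) + d₂ - d₀ - d₃) * ((d₃ : ℝ) - d₂) * ((d₃ : ℝ) - d₁))) :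
    ((Matrix.det (((X : ℝ[X]) ^ e) • J.map Polynomial.C
        + (Polynomial.C w₀ * X ^ d₀) • (vecMulVec v₀ v₀).map Polynomial.C
        + (Polynomial.C w₁ * X ^ d₁) • (vecMulVec v₁ v₁).map Polynomial.C
        + (Polynomial.C w₂ * X ^ d₂) • (vecMulVec v₂ v₂).map Polynomial.C
        + (Polynomial.C w₃ * X ^ d₃) • (vecMulVec v₃ v₃).map Polynomial.C)).roots.toFinset.filter (fun t => 0 < t)).card
      ≤ 7 := by
  rw [det_rankOne_four_sum]
  exact elevenNomial_oneThree_T12_le_seven e d₀ d₁ d₂ d₃ h0e he1 h12 h23 hC3 hC4 hC5 hC6 J.det _ _ _ _ w₀ w₁ w₂ w₃ _ _ _ _ _ _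
    hw₁ hw₂ hm₁ (by positivity) hw₀ hw₃ hm₀ hD23 hS

/-- **T02: `Z₊ ≤ 7`.**  As the tree's `elevenNomial_oneThree_T02_le_eight` (same exponent hypotheses and kill condition, coefficient data otherwise arbitrary) plus the
sign hypotheses that make the count odd (letter `0` core: `m₀ < 0`; letters `2, 3` not parallel: `D₂₃ > 0`; positive weights): the kills counted
WITH multiplicity give `pos ≤ 8` with multiplicity, and parity gives `7`. -/
theorem elevenNomial_oneThree_T02_le_seven (e d₀ d₁ d₂ d₃ : ℕ) (h0e : d₀ < e) (he1 : e < d₁) (h12 : d₁ < d₂) (h23 : d₂ < d₃)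
    (hC1 : d₀ + d₁ < 2 * e) (hC2 : 2 * e < d₀ + d₂) (hC5 : d₀ + d₃ < e + d₂)
    (dJ m₀ m₁ m₂ m₃ w₀ w₁ w₂ w₃ D01 D02 D03 D12 D13 D23 : ℝ) (hw₀ : 0 < w₀) (hw₂ : 0 < w₂) (hm₂ : m₂ < 0) (hdJ : dJ < 0) (hw₃ : 0 < w₃) (hm₀ : m₀ < 0) (hD23 : 0 < D23)
    (hS : (-dJ) * D02
        * (((d₁ : ℝ) - e) * ((d₃ : ℝ) - e) * ((2 : ℝ) * e - d₀ - d₁) * ((d₀ : ℝ) + d₃ - 2 * e) * ((d₁ : ℝ) + d₂ - 2 * e) * ((d₁ : ℝ) + d₃ - 2 * e) * ((d₂ : ℝ) + d₃ - 2 * e))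
        * (((e : ℝ) + d₁ - d₀ - d₂) * ((e : ℝ) + d₃ - d₀ - d₂) * ((d₂ : ℝ) - d₁) * ((d₃ : ℝ) - d₂) * ((d₁ : ℝ) - d₀) * ((d₁ : ℝ) + d₃ - d₀ - d₂) * ((d₃ : ℝ) - d₀))
        ≤ m₀ * m₂
        * (((d₁ : ℝ) - d₀) * ((d₃ : ℝ) - d₀) * ((d₁ : ℝ) - e) * ((d₃ : ℝ) - e) * ((d₁ : ℝ) + d₂ - e - d₀) * ((d₁ : ℝ) + d₃ - e - d₀) * ((d₂ : ℝ) + d₃ - e - d₀))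
        * (((d₂ : ℝ) - d₁) * ((d₃ : ℝ) - d₂) * ((e : ℝ) + d₂ - d₀ - d₁) * ((e : ℝ) + d₂ - d₀ - d₃) * ((d₁ : ℝ) - e) * ((d₁ : ℝ) + d₃ - e - d₂) * ((d₃ : ℝ) - e))) :
    ((∑ i : Fin 11, Polynomial.C ((![dJ, w₀ * m₀, w₁ * m₁, w₂ * m₂, w₃ * m₃, w₀ * w₁ * D01, w₀ * w₂ * D02, w₀ * w₃ * D03, w₁ * w₂ * D12, w₁ * w₃ * D13, w₂ * w₃ * D23] : Fin 11 → ℝ) i) * X ^ ((![2 * e, e + d₀, e + d₁, e + d₂, e + d₃, d₀ + d₁, d₀ + d₂, d₀ + d₃, d₁ + d₂, d₁ + d₃, d₂ + d₃] : Fin 11 → ℕ) i)).roots.toFinset.filter (fun t => 0 < t)).card ≤ 7 := by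
  classical
  have h8 : (∑ i : Fin 11, Polynomial.C ((![dJ, w₀ * m₀, w₁ * m₁, w₂ * m₂, w₃ * m₃, w₀ * w₁ * D01, w₀ * w₂ * D02, w₀ * w₃ * D03, w₁ * w₂ * D12, w₁ * w₃ * D13, w₂ * w₃ * D23] : Fin 11 → ℝ) i) * X ^ ((![2 * e, e + d₀, e + d₁, e + d₂, e + d₃, d₀ + d₁, d₀ + d₂, d₀ + d₃, d₁ + d₂, d₁ + d₃, d₂ + d₃] : Fin 11 → ℕ) i)).roots.countP (fun x => 0 < x) ≤ 8 := by
    have h0e' : (d₀ : ℝ) < e := by exact_mod_cast h0e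
    have he1' : (e : ℝ) < d₁ := by exact_mod_cast he1
    have h12' : (d₁ : ℝ) < d₂ := by exact_mod_cast h12
    have h23' : (d₂ : ℝ) < d₃ := by exact_mod_cast h23
    have hC1' : (d₀ : ℝ) + d₁ < 2 * e := by exact_mod_cast hC1
    have hC2' : 2 * (e : ℝ) < d₀ + d₂ := by exact_mod_cast hC2
    have hC5' : (d₀ : ℝ) + d₃ < e + d₂ := by exact_mod_cast hC5
    -- the four distance products (positive atoms)
    obtain ⟨PA, hPA⟩ : ∃ x : ℝ, x = ((d₁ : ℝ) - d₀) * ((d₃ : ℝ) - d₀) * ((d₁ : ℝ) - e) * ((d₃ : ℝ) - e) * ((d₁ : ℝ) + d₂ - e - d₀) * ((d₁ : ℝ) + d₃ - e - d₀) * ((d₂ : ℝ) + d₃ - e - d₀) := ⟨_, rfl⟩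
    obtain ⟨PB, hPB⟩ : ∃ x : ℝ, x = ((d₁ : ℝ) - e) * ((d₃ : ℝ) - e) * ((2 : ℝ) * e - d₀ - d₁) * ((d₀ : ℝ) + d₃ - 2 * e) * ((d₁ : ℝ) + d₂ - 2 * e) * ((d₁ : ℝ) + d₃ - 2 * e) * ((d₂ : ℝ) + d₃ - 2 * e) := ⟨_, rfl⟩
    obtain ⟨PC, hPC⟩ : ∃ x : ℝ, x = ((e : ℝ) + d₁ - d₀ - d₂) * ((e : ℝ) + d₃ - d₀ - d₂) * ((d₂ : ℝ) - d₁) * ((d₃ : ℝ) - d₂) * ((d₁ : ℝ) - d₀) * ((d₁ : ℝ) + d₃ - d₀ - d₂) * ((d₃ : ℝ) - d₀) := ⟨_, rfl⟩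
    obtain ⟨PD, hPD⟩ : ∃ x : ℝ, x = ((d₂ : ℝ) - d₁) * ((d₃ : ℝ) - d₂) * ((e : ℝ) + d₂ - d₀ - d₁) * ((e : ℝ) + d₂ - d₀ - d₃) * ((d₁ : ℝ) - e) * ((d₁ : ℝ) + d₃ - e - d₂) * ((d₃ : ℝ) - e) := ⟨_, rfl⟩
    have hS' : (-dJ) * D02 * PB * PC ≤ m₀ * m₂ * PA * PD := by rw [hPA, hPB, hPC, hPD]; exact hS
    clear hS
    have hPBp : 0 < PB := by
      rw [hPB]
      have f1 : 0 < ((d₁ : ℝ) - e) := by linarith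
      have f2 : 0 < ((d₃ : ℝ) - e) := by linarith
      have f3 : 0 < ((2 : ℝ) * e - d₀ - d₁) := by linarith
      have f4 : 0 < ((d₀ : ℝ) + d₃ - 2 * e) := by linarith
      have f5 : 0 < ((d₁ : ℝ) + d₂ - 2 * e) := by linarith
      have f6 : 0 < ((d₁ : ℝ) + d₃ - 2 * e) := by linarith
      have f7 : 0 < ((d₂ : ℝ) + d₃ - 2 * e) := by linarith
      exact mul_pos (mul_pos (mul_pos (mul_pos (mul_pos (mul_pos f1 f2) f3) f4) f5) f6) f7
    have hPDp : 0 < PD := by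
      rw [hPD]
      have f1 : 0 < ((d₂ : ℝ) - d₁) := by linarith
      have f2 : 0 < ((d₃ : ℝ) - d₂) := by linarith
      have f3 : 0 < ((e : ℝ) + d₂ - d₀ - d₁) := by linarith
      have f4 : 0 < ((e : ℝ) + d₂ - d₀ - d₃) := by linarith
      have f5 : 0 < ((d₁ : ℝ) - e) := by linarith
      have f6 : 0 < ((d₁ : ℝ) + d₃ - e - d₂) := by linarith
      have f7 : 0 < ((d₃ : ℝ) - e) := by linarith
      exact mul_pos (mul_pos (mul_pos (mul_pos (mul_pos (mul_pos f1 f2) f3) f4) f5) f6) f7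
    -- the four surviving coefficients
    obtain ⟨A, hA⟩ : ∃ x : ℝ, x = w₀ * (-m₀) * PA := ⟨_, rfl⟩
    obtain ⟨B, hB⟩ : ∃ x : ℝ, x = (-dJ) * PB := ⟨_, rfl⟩
    obtain ⟨C, hC⟩ : ∃ x : ℝ, x = w₀ * w₂ * D02 * PC := ⟨_, rfl⟩
    obtain ⟨D, hD⟩ : ∃ x : ℝ, x = w₂ * (-m₂) * PD := ⟨_, rfl⟩
    have hBp : 0 < B := by rw [hB]; exact mul_pos (by linarith) hPBp
    have hDp : 0 < D := by rw [hD]; exact mul_pos (mul_pos hw₂ (by linarith)) hPDp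
    have hBC : B * C ≤ A * D := by
      have e1 : B * C = (w₀ * w₂) * ((-dJ) * D02 * PB * PC) := by rw [hB, hC]; ring
      have e2 : A * D = (w₀ * w₂) * (m₀ * m₂ * PA * PD) := by rw [hA, hD]; ring
      rw [e1, e2]
      exact mul_le_mul_of_nonneg_left hS' (mul_pos hw₀ hw₂).le
    -- seven kills
    have hkills := countP_posRoots_le_kills (Finset.univ : Finset (Fin 11)) (![2 * e, e + d₀, e + d₁, e + d₂, e + d₃, d₀ + d₁, d₀ + d₂, d₀ + d₃, d₁ + d₂, d₁ + d₃, d₂ + d₃] : Fin 11 → ℕ) [e + d₁, e + d₃, d₀ + d₁, d₀ + d₃, d₁ + d₂, d₁ + d₃, d₂ + d₃] (![dJ, w₀ * m₀, w₁ * m₁, w₂ * m₂, w₃ * m₃, w₀ * w₁ * D01, w₀ * w₂ * D02, w₀ * w₃ * D03, w₁ * w₂ * D12, w₁ * w₃ * D13, w₂ * w₃ * D23] : Fin 11 → ℝ)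
    have hfour : (∑ i ∈ (Finset.univ : Finset (Fin 11)), Polynomial.C ((![dJ, w₀ * m₀, w₁ * m₁, w₂ * m₂, w₃ * m₃, w₀ * w₁ * D01, w₀ * w₂ * D02, w₀ * w₃ * D03, w₁ * w₂ * D12, w₁ * w₃ * D13, w₂ * w₃ * D23] : Fin 11 → ℝ) i
            * (([e + d₁, e + d₃, d₀ + d₁, d₀ + d₃, d₁ + d₂, d₁ + d₃, d₂ + d₃]).map (fun ρ : ℕ => (((((![2 * e, e + d₀, e + d₁, e + d₂, e + d₃, d₀ + d₁, d₀ + d₂, d₀ + d₃, d₁ + d₂, d₁ + d₃, d₂ + d₃] : Fin 11 → ℕ)) i : ℕ) : ℝ) - (ρ : ℝ)))).prod) * X ^ ((![2 * e, e + d₀, e + d₁, e + d₂, e + d₃, d₀ + d₁, d₀ + d₂, d₀ + d₃, d₁ + d₂, d₁ + d₃, d₂ + d₃] : Fin 11 → ℕ) i))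
        = (Polynomial.C A * X ^ (e + d₀) - Polynomial.C B * X ^ (e + d₀ + (e - d₀))
            + Polynomial.C C * X ^ (e + d₀ + (d₂ - e)) - Polynomial.C D * X ^ (e + d₀ + (e - d₀) + (d₂ - e))) := by
      have e3 : e + d₀ + (e - d₀) + (d₂ - e) = e + d₂ := by omega
      have e1 : e + d₀ + (e - d₀) = 2 * e := by omega
      have e2 : e + d₀ + (d₂ - e) = d₀ + d₂ := by omega
      rw [e3, e1, e2]
      have hcoef : ∀ i : Fin 11, (![dJ, w₀ * m₀, w₁ * m₁, w₂ * m₂, w₃ * m₃, w₀ * w₁ * D01, w₀ * w₂ * D02, w₀ * w₃ * D03, w₁ * w₂ * D12, w₁ * w₃ * D13, w₂ * w₃ * D23] : Fin 11 → ℝ) i * (([e + d₁, e + d₃, d₀ + d₁, d₀ + d₃, d₁ + d₂, d₁ + d₃, d₂ + d₃]).map (fun ρ : ℕ => (((((![2 * e, e + d₀, e + d₁, e + d₂, e + d₃, d₀ + d₁, d₀ + d₂, d₀ + d₃, d₁ + d₂, d₁ + d₃, d₂ + d₃] : Fin 11 → ℕ)) i : ℕ) : ℝ) - (ρ : ℝ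)))).prod
          = (![-B, A, 0, -D, 0, 0, C, 0, 0, 0, 0] : Fin 11 → ℝ) i := by
        intro i
        fin_cases i <;>
          simp only [Fin.zero_eta, Fin.mk_one, Fin.isValue, Matrix.cons_val_zero, Matrix.cons_val_one,
            List.map_cons, List.map_nil, List.prod_cons, List.prod_nil, hA, hB, hC, hD, hPA, hPB, hPC, hPD] <;>
          push_cast <;> ring
      rw [Finset.sum_congr rfl (fun i _ => by rw [hcoef i])]
      simp only [Fin.sum_univ_succ, Fin.sum_univ_zero, Matrix.cons_val_zero, Matrix.cons_val_succ, map_zero, zero_mul,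
        zero_add, add_zero, Polynomial.C_neg]
      ring
    rw [hfour] at hkills
    have hone := countP_posRoots_fourNomial_le_one A B C D hBp hDp hBC (e + d₀) (e - d₀) (d₂ - e) (by omega)
    simp only [List.length_cons, List.length_nil] at hkills
    omega
  have hodd := elevenNomial_oneThree_odd e d₀ d₁ d₂ d₃ h0e he1 h12 h23 dJ m₀ m₁ m₂ m₃ w₀ w₁ w₂ w₃ D01 D02 D03 D12 D13 D23
    (mul_neg_of_pos_of_neg hw₀ hm₀) (mul_pos (mul_pos hw₂ hw₃) hD23)
  have h7 := card_posRoots_le_pred_of_odd _ 4 hodd (by omega)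
  omega

/-- **Matrix form: `Z₊ ≤ 7`** (as the tree's `oneThree_rankOne_posRoots_le_eight_of_T02`, plus letter `0` core, letters `2, 3` not parallel, positive weights). -/
theorem oneThree_rankOne_posRoots_le_seven_of_T02 (e d₀ d₁ d₂ d₃ : ℕ) (h0e : d₀ < e) (he1 : e < d₁) (h12 : d₁ < d₂) (h23 : d₂ < d₃)
    (hC1 : d₀ + d₁ < 2 * e) (hC2 : 2 * e < d₀ + d₂) (hC5 : d₀ + d₃ < e + d₂)
    (J : Matrix (Fin 2) (Fin 2) ℝ) (v₀ v₁ v₂ v₃ : Fin 2 → ℝ) (w₀ w₁ w₂ w₃ : ℝ) (hw₀ : 0 < w₀) (hw₂ : 0 < w₂) (hm₂ : (J 0 0 * v₂ 1 ^ 2 + J 1 1 * v₂ 0 ^ 2 - (J 0 1 + J 1 0) * (v₂ 0 * v₂ 1)) < 0) (hJ : J.det < 0)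
    (hw₃ : 0 < w₃) (hm₀ : (J 0 0 * v₀ 1 ^ 2 + J 1 1 * v₀ 0 ^ 2 - (J 0 1 + J 1 0) * (v₀ 0 * v₀ 1)) < 0) (hD23 : 0 < (v₂ 0 * v₃ 1 - v₂ 1 * v₃ 0) ^ 2)
    (hS : (-J.det) * ((v₀ 0 * v₂ 1 - v₀ 1 * v₂ 0) ^ 2)
        * (((d₁ : ℝ) - e) * ((d₃ : ℝ) - e) * ((2 : ℝ) * e - d₀ - d₁) * ((d₀ : ℝ) + d₃ - 2 * e) * ((d₁ : ℝ) + d₂ - 2 * e) * ((d₁ : ℝ) + d₃ - 2 * e) * ((d₂ : ℝ) + d₃ - 2 * e))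
        * (((e : ℝ) + d₁ - d₀ - d₂) * ((e : ℝ) + d₃ - d₀ - d₂) * ((d₂ : ℝ) - d₁) * ((d₃ : ℝ) - d₂) * ((d₁ : ℝ) - d₀) * ((d₁ : ℝ) + d₃ - d₀ - d₂) * ((d₃ : ℝ) - d₀))
        ≤ (J 0 0 * v₀ 1 ^ 2 + J 1 1 * v₀ 0 ^ 2 - (J 0 1 + J 1 0) * (v₀ 0 * v₀ 1)) * (J 0 0 * v₂ 1 ^ 2 + J 1 1 * v₂ 0 ^ 2 - (J 0 1 + J 1 0) * (v₂ 0 * v₂ 1))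
        * (((d₁ : ℝ) - d₀) * ((d₃ : ℝ) - d₀) * ((d₁ : ℝ) - e) * ((d₃ : ℝ) - e) * ((d₁ : ℝ) + d₂ - e - d₀) * ((d₁ : ℝ) + d₃ - e - d₀) * ((d₂ : ℝ) + d₃ - e - d₀))
        * (((d₂ : ℝ) - d₁) * ((d₃ : ℝ) - d₂) * ((e : ℝ) + d₂ - d₀ - d₁) * ((e : ℝ) + d₂ - d₀ - d₃) * ((d₁ : ℝ) - e) * ((d₁ : ℝ) + d₃ - e - d₂) * ((d₃ : ℝ) - e))) :
    ((Matrix.det (((X : ℝ[X]) ^ e) • J.map Polynomial.C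
        + (Polynomial.C w₀ * X ^ d₀) • (vecMulVec v₀ v₀).map Polynomial.C
        + (Polynomial.C w₁ * X ^ d₁) • (vecMulVec v₁ v₁).map Polynomial.C
        + (Polynomial.C w₂ * X ^ d₂) • (vecMulVec v₂ v₂).map Polynomial.C
        + (Polynomial.C w₃ * X ^ d₃) • (vecMulVec v₃ v₃).map Polynomial.C)).roots.toFinset.filter (fun t => 0 < t)).card
      ≤ 7 := by
  rw [det_rankOne_four_sum]
  exact elevenNomial_oneThree_T02_le_seven e d₀ d₁ d₂ d₃ h0e he1 h12 h23 hC1 hC2 hC5 J.det _ _ _ _ w₀ w₁ w₂ w₃ _ _ _ _ _ _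
    hw₀ hw₂ hm₂ hJ hw₃ hm₀ hD23 hS

/-- **T13: `Z₊ ≤ 7`.**  As the tree's `elevenNomial_oneThree_T13_le_eight` (same exponent hypotheses and kill condition, coefficient data otherwise arbitrary) plus the
sign hypotheses that make the count odd (letter `0` core: `m₀ < 0`; letters `2, 3` not parallel: `D₂₃ > 0`; positive weights): the kills counted
WITH multiplicity give `pos ≤ 8` with multiplicity, and parity gives `7`. -/
theorem elevenNomial_oneThree_T13_le_seven (e d₀ d₁ d₂ d₃ : ℕ) (h0e : d₀ < e) (he1 : e < d₁) (h12 : d₁ < d₂) (h23 : d₂ < d₃)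
    (hC3 : d₀ + d₂ < e + d₁) (hC4 : e + d₁ < d₀ + d₃)
    (dJ m₀ m₁ m₂ m₃ w₀ w₁ w₂ w₃ D01 D02 D03 D12 D13 D23 : ℝ) (hw₁ : 0 < w₁) (hw₃ : 0 < w₃) (hm₁ : m₁ < 0) (hD13 : 0 < D13) (hw₀ : 0 < w₀) (hw₂ : 0 < w₂) (hm₀ : m₀ < 0) (hD23 : 0 < D23)
    (hS : m₁ * m₃
        * (((d₁ : ℝ) - d₀) * ((d₂ : ℝ) - d₁) * ((e : ℝ) - d₀) * ((e : ℝ) + d₁ - d₀ - d₂) * ((d₀ : ℝ) + d₃ - e - d₁) * ((d₂ : ℝ) - e) * ((d₂ : ℝ) + d₃ - e - d₁))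
        * (((d₃ : ℝ) - d₀) * ((d₃ : ℝ) - d₂) * ((e : ℝ) + d₃ - d₀ - d₁) * ((e : ℝ) + d₃ - d₀ - d₂) * ((e : ℝ) - d₀) * ((e : ℝ) + d₃ - d₁ - d₂) * ((d₂ : ℝ) - e))
        ≤ (-dJ) * D13
        * (((e : ℝ) - d₀) * ((d₂ : ℝ) - e) * ((2 : ℝ) * e - d₀ - d₁) * ((d₀ : ℝ) + d₂ - 2 * e) * ((d₀ : ℝ) + d₃ - 2 * e) * ((d₁ : ℝ) + d₂ - 2 * e) * ((d₂ : ℝ) + d₃ - 2 * e))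
        * (((d₁ : ℝ) + d₃ - e - d₀) * ((d₁ : ℝ) + d₃ - e - d₂) * ((d₃ : ℝ) - d₀) * ((d₁ : ℝ) + d₃ - d₀ - d₂) * ((d₁ : ℝ) - d₀) * ((d₃ : ℝ) - d₂) * ((d₂ : ℝ) - d₁))) :
    ((∑ i : Fin 11, Polynomial.C ((![dJ, w₀ * m₀, w₁ * m₁, w₂ * m₂, w₃ * m₃, w₀ * w₁ * D01, w₀ * w₂ * D02, w₀ * w₃ * D03, w₁ * w₂ * D12, w₁ * w₃ * D13, w₂ * w₃ * D23] : Fin 11 → ℝ) i) * X ^ ((![2 * e, e + d₀, e + d₁, e + d₂, e + d₃, d₀ + d₁, d₀ + d₂, d₀ + d₃, d₁ + d₂, d₁ + d₃, d₂ + d₃] : Fin 11 → ℕ) i)).roots.toFinset.filter (fun t => 0 < t)).card ≤ 7 := by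
  classical
  have h8 : (∑ i : Fin 11, Polynomial.C ((![dJ, w₀ * m₀, w₁ * m₁, w₂ * m₂, w₃ * m₃, w₀ * w₁ * D01, w₀ * w₂ * D02, w₀ * w₃ * D03, w₁ * w₂ * D12, w₁ * w₃ * D13, w₂ * w₃ * D23] : Fin 11 → ℝ) i) * X ^ ((![2 * e, e + d₀, e + d₁, e + d₂, e + d₃, d₀ + d₁, d₀ + d₂, d₀ + d₃, d₁ + d₂, d₁ + d₃, d₂ + d₃] : Fin 11 → ℕ) i)).roots.countP (fun x => 0 < x) ≤ 8 := by
    have h0e' : (d₀ : ℝ) < e := by exact_mod_cast h0e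
    have he1' : (e : ℝ) < d₁ := by exact_mod_cast he1
    have h12' : (d₁ : ℝ) < d₂ := by exact_mod_cast h12
    have h23' : (d₂ : ℝ) < d₃ := by exact_mod_cast h23
    have hC3' : (d₀ : ℝ) + d₂ < e + d₁ := by exact_mod_cast hC3
    have hC4' : (e : ℝ) + d₁ < d₀ + d₃ := by exact_mod_cast hC4
    -- the four distance products (positive atoms)
    obtain ⟨PA, hPA⟩ : ∃ x : ℝ, x = ((e : ℝ) - d₀) * ((d₂ : ℝ) - e) * ((2 : ℝ) * e - d₀ - d₁) * ((d₀ : ℝ) + d₂ - 2 * e) * ((d₀ : ℝ) + d₃ - 2 * e) * ((d₁ : ℝ) + d₂ - 2 * e) * ((d₂ : ℝ) + d₃ - 2 * e) := ⟨_, rfl⟩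
    obtain ⟨PB, hPB⟩ : ∃ x : ℝ, x = ((d₁ : ℝ) - d₀) * ((d₂ : ℝ) - d₁) * ((e : ℝ) - d₀) * ((e : ℝ) + d₁ - d₀ - d₂) * ((d₀ : ℝ) + d₃ - e - d₁) * ((d₂ : ℝ) - e) * ((d₂ : ℝ) + d₃ - e - d₁) := ⟨_, rfl⟩
    obtain ⟨PC, hPC⟩ : ∃ x : ℝ, x = ((d₃ : ℝ) - d₀) * ((d₃ : ℝ) - d₂) * ((e : ℝ) + d₃ - d₀ - d₁) * ((e : ℝ) + d₃ - d₀ - d₂) * ((e : ℝ) - d₀) * ((e : ℝ) + d₃ - d₁ - d₂) * ((d₂ : ℝ) - e) := ⟨_, rfl⟩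
    obtain ⟨PD, hPD⟩ : ∃ x : ℝ, x = ((d₁ : ℝ) + d₃ - e - d₀) * ((d₁ : ℝ) + d₃ - e - d₂) * ((d₃ : ℝ) - d₀) * ((d₁ : ℝ) + d₃ - d₀ - d₂) * ((d₁ : ℝ) - d₀) * ((d₃ : ℝ) - d₂) * ((d₂ : ℝ) - d₁) := ⟨_, rfl⟩
    have hS' : m₁ * m₃ * PB * PC ≤ (-dJ) * D13 * PA * PD := by rw [hPA, hPB, hPC, hPD]; exact hS
    clear hS
    have hPBp : 0 < PB := by
      rw [hPB]
      have f1 : 0 < ((d₁ : ℝ) - d₀) := by linarith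
      have f2 : 0 < ((d₂ : ℝ) - d₁) := by linarith
      have f3 : 0 < ((e : ℝ) - d₀) := by linarith
      have f4 : 0 < ((e : ℝ) + d₁ - d₀ - d₂) := by linarith
      have f5 : 0 < ((d₀ : ℝ) + d₃ - e - d₁) := by linarith
      have f6 : 0 < ((d₂ : ℝ) - e) := by linarith
      have f7 : 0 < ((d₂ : ℝ) + d₃ - e - d₁) := by linarith
      exact mul_pos (mul_pos (mul_pos (mul_pos (mul_pos (mul_pos f1 f2) f3) f4) f5) f6) f7
    have hPDp : 0 < PD := by
      rw [hPD]
      have f1 : 0 < ((d₁ : ℝ) + d₃ - e - d₀) := by linarith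
      have f2 : 0 < ((d₁ : ℝ) + d₃ - e - d₂) := by linarith
      have f3 : 0 < ((d₃ : ℝ) - d₀) := by linarith
      have f4 : 0 < ((d₁ : ℝ) + d₃ - d₀ - d₂) := by linarith
      have f5 : 0 < ((d₁ : ℝ) - d₀) := by linarith
      have f6 : 0 < ((d₃ : ℝ) - d₂) := by linarith
      have f7 : 0 < ((d₂ : ℝ) - d₁) := by linarith
      exact mul_pos (mul_pos (mul_pos (mul_pos (mul_pos (mul_pos f1 f2) f3) f4) f5) f6) f7
    -- the four surviving coefficients
    obtain ⟨A, hA⟩ : ∃ x : ℝ, x = (-dJ) * PA := ⟨_, rfl⟩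
    obtain ⟨B, hB⟩ : ∃ x : ℝ, x = w₁ * (-m₁) * PB := ⟨_, rfl⟩
    obtain ⟨C, hC⟩ : ∃ x : ℝ, x = w₃ * (-m₃) * PC := ⟨_, rfl⟩
    obtain ⟨D, hD⟩ : ∃ x : ℝ, x = w₁ * w₃ * D13 * PD := ⟨_, rfl⟩
    have hBp : 0 < B := by rw [hB]; exact mul_pos (mul_pos hw₁ (by linarith)) hPBp
    have hDp : 0 < D := by rw [hD]; exact mul_pos (mul_pos (mul_pos hw₁ hw₃) hD13) hPDp
    have hBC : B * C ≤ A * D := by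
      have e1 : B * C = (w₁ * w₃) * (m₁ * m₃ * PB * PC) := by rw [hB, hC]; ring
      have e2 : A * D = (w₁ * w₃) * ((-dJ) * D13 * PA * PD) := by rw [hA, hD]; ring
      rw [e1, e2]
      exact mul_le_mul_of_nonneg_left hS' (mul_pos hw₁ hw₃).le
    -- seven kills
    have hkills := countP_posRoots_le_kills (Finset.univ : Finset (Fin 11)) (![2 * e, e + d₀, e + d₁, e + d₂, e + d₃, d₀ + d₁, d₀ + d₂, d₀ + d₃, d₁ + d₂, d₁ + d₃, d₂ + d₃] : Fin 11 → ℕ) [e + d₀, e + d₂, d₀ + d₁, d₀ + d₂, d₀ + d₃, d₁ + d₂, d₂ + d₃] (![dJ, w₀ * m₀, w₁ * m₁, w₂ * m₂, w₃ * m₃, w₀ * w₁ * D01, w₀ * w₂ * D02, w₀ * w₃ * D03, w₁ * w₂ * D12, w₁ * w₃ * D13, w₂ * w₃ * D23] : Fin 11 → ℝ)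
    have hfour : (∑ i ∈ (Finset.univ : Finset (Fin 11)), Polynomial.C ((![dJ, w₀ * m₀, w₁ * m₁, w₂ * m₂, w₃ * m₃, w₀ * w₁ * D01, w₀ * w₂ * D02, w₀ * w₃ * D03, w₁ * w₂ * D12, w₁ * w₃ * D13, w₂ * w₃ * D23] : Fin 11 → ℝ) i
            * (([e + d₀, e + d₂, d₀ + d₁, d₀ + d₂, d₀ + d₃, d₁ + d₂, d₂ + d₃]).map (fun ρ : ℕ => (((((![2 * e, e + d₀, e + d₁, e + d₂, e + d₃, d₀ + d₁, d₀ + d₂, d₀ + d₃, d₁ + d₂, d₁ + d₃, d₂ + d₃] : Fin 11 → ℕ)) i : ℕ) : ℝ) - (ρ : ℝ)))).prod) * X ^ ((![2 * e, e + d₀, e + d₁, e + d₂, e + d₃, d₀ + d₁, d₀ + d₂, d₀ + d₃, d₁ + d₂, d₁ + d₃, d₂ + d₃] : Fin 11 → ℕ) i))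
        = (Polynomial.C A * X ^ (2 * e) - Polynomial.C B * X ^ (2 * e + (d₁ - e))
            + Polynomial.C C * X ^ (2 * e + (d₃ - e)) - Polynomial.C D * X ^ (2 * e + (d₁ - e) + (d₃ - e))) := by
      have e3 : 2 * e + (d₁ - e) + (d₃ - e) = d₁ + d₃ := by omega
      have e1 : 2 * e + (d₁ - e) = e + d₁ := by omega
      have e2 : 2 * e + (d₃ - e) = e + d₃ := by omega
      rw [e3, e1, e2]
      have hcoef : ∀ i : Fin 11, (![dJ, w₀ * m₀, w₁ * m₁, w₂ * m₂, w₃ * m₃, w₀ * w₁ * D01, w₀ * w₂ * D02, w₀ * w₃ * D03, w₁ * w₂ * D12, w₁ * w₃ * D13, w₂ * w₃ * D23] : Fin 11 → ℝ) i * (([e + d₀, e + d₂, d₀ + d₁, d₀ + d₂, d₀ + d₃, d₁ + d₂, d₂ + d₃]).map (fun ρ : ℕ => (((((![2 * e, e + d₀, e + d₁, e + d₂, e + d₃, d₀ + d₁, d₀ + d₂, d₀ + d₃, d₁ + d₂, d₁ + d₃, d₂ + d₃] : Fin 11 → ℕ)) i : ℕ) : ℝ) - (ρ : ℝ)))).p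rod
          = (![A, 0, -B, 0, C, 0, 0, 0, 0, -D, 0] : Fin 11 → ℝ) i := by
        intro i
        fin_cases i <;>
          simp only [Fin.zero_eta, Fin.mk_one, Fin.isValue, Matrix.cons_val_zero, Matrix.cons_val_one,
            List.map_cons, List.map_nil, List.prod_cons, List.prod_nil, hA, hB, hC, hD, hPA, hPB, hPC, hPD] <;>
          push_cast <;> ring
      rw [Finset.sum_congr rfl (fun i _ => by rw [hcoef i])]
      simp only [Fin.sum_univ_succ, Fin.sum_univ_zero, Matrix.cons_val_zero, Matrix.cons_val_succ, map_zero, zero_mul,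
        zero_add, add_zero, Polynomial.C_neg]
      ring
    rw [hfour] at hkills
    have hone := countP_posRoots_fourNomial_le_one A B C D hBp hDp hBC (2 * e) (d₁ - e) (d₃ - e) (by omega)
    simp only [List.length_cons, List.length_nil] at hkills
    omega
  have hodd := elevenNomial_oneThree_odd e d₀ d₁ d₂ d₃ h0e he1 h12 h23 dJ m₀ m₁ m₂ m₃ w₀ w₁ w₂ w₃ D01 D02 D03 D12 D13 D23
    (mul_neg_of_pos_of_neg hw₀ hm₀) (mul_pos (mul_pos hw₂ hw₃) hD23)
  have h7 := card_posRoots_le_pred_of_odd _ 4 hodd (by omega)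
  omega

/-- **Matrix form: `Z₊ ≤ 7`** (as the tree's `oneThree_rankOne_posRoots_le_eight_of_T13`, plus letter `0` core, letters `2, 3` not parallel, positive weights). -/
theorem oneThree_rankOne_posRoots_le_seven_of_T13 (e d₀ d₁ d₂ d₃ : ℕ) (h0e : d₀ < e) (he1 : e < d₁) (h12 : d₁ < d₂) (h23 : d₂ < d₃)
    (hC3 : d₀ + d₂ < e + d₁) (hC4 : e + d₁ < d₀ + d₃)
    (J : Matrix (Fin 2) (Fin 2) ℝ) (v₀ v₁ v₂ v₃ : Fin 2 → ℝ) (w₀ w₁ w₂ w₃ : ℝ) (hw₁ : 0 < w₁) (hw₃ : 0 < w₃) (hm₁ : (J 0 0 * v₁ 1 ^ 2 + J 1 1 * v₁ 0 ^ 2 - (J 0 1 + J 1 0) * (v₁ 0 * v₁ 1)) < 0)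
    (hv13 : v₁ 0 * v₃ 1 - v₁ 1 * v₃ 0 ≠ 0)
    (hw₀ : 0 < w₀) (hw₂ : 0 < w₂) (hm₀ : (J 0 0 * v₀ 1 ^ 2 + J 1 1 * v₀ 0 ^ 2 - (J 0 1 + J 1 0) * (v₀ 0 * v₀ 1)) < 0) (hD23 : 0 < (v₂ 0 * v₃ 1 - v₂ 1 * v₃ 0) ^ 2)
    (hS : (J 0 0 * v₁ 1 ^ 2 + J 1 1 * v₁ 0 ^ 2 - (J 0 1 + J 1 0) * (v₁ 0 * v₁ 1)) * (J 0 0 * v₃ 1 ^ 2 + J 1 1 * v₃ 0 ^ 2 - (J 0 1 + J 1 0) * (v₃ 0 * v₃ 1))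
        * (((d₁ : ℝ) - d₀) * ((d₂ : ℝ) - d₁) * ((e : ℝ) - d₀) * ((e : ℝ) + d₁ - d₀ - d₂) * ((d₀ : ℝ) + d₃ - e - d₁) * ((d₂ : ℝ) - e) * ((d₂ : ℝ) + d₃ - e - d₁))
        * (((d₃ : ℝ) - d₀) * ((d₃ : ℝ) - d₂) * ((e : ℝ) + d₃ - d₀ - d₁) * ((e : ℝ) + d₃ - d₀ - d₂) * ((e : ℝ) - d₀) * ((e : ℝ) + d₃ - d₁ - d₂) * ((d₂ : ℝ) - e))
        ≤ (-J.det) * ((v₁ 0 * v₃ 1 - v₁ 1 * v₃ 0) ^ 2)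
        * (((e : ℝ) - d₀) * ((d₂ : ℝ) - e) * ((2 : ℝ) * e - d₀ - d₁) * ((d₀ : ℝ) + d₂ - 2 * e) * ((d₀ : ℝ) + d₃ - 2 * e) * ((d₁ : ℝ) + d₂ - 2 * e) * ((d₂ : ℝ) + d₃ - 2 * e))
        * (((d₁ : ℝ) + d₃ - e - d₀) * ((d₁ : ℝ) + d₃ - e - d₂) * ((d₃ : ℝ) - d₀) * ((d₁ : ℝ) + d₃ - d₀ - d₂) * ((d₁ : ℝ) - d₀) * ((d₃ : ℝ) - d₂) * ((d₂ : ℝ) - d₁))) :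
    ((Matrix.det (((X : ℝ[X]) ^ e) • J.map Polynomial.C
        + (Polynomial.C w₀ * X ^ d₀) • (vecMulVec v₀ v₀).map Polynomial.C
        + (Polynomial.C w₁ * X ^ d₁) • (vecMulVec v₁ v₁).map Polynomial.C
        + (Polynomial.C w₂ * X ^ d₂) • (vecMulVec v₂ v₂).map Polynomial.C
        + (Polynomial.C w₃ * X ^ d₃) • (vecMulVec v₃ v₃).map Polynomial.C)).roots.toFinset.filter (fun t => 0 < t)).card
      ≤ 7 := by
  rw [det_rankOne_four_sum]
  exact elevenNomial_oneThree_T13_le_seven e d₀ d₁ d₂ d₃ h0e he1 h12 h23 hC3 hC4 J.det _ _ _ _ w₀ w₁ w₂ w₃ _ _ _ _ _ _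
    hw₁ hw₃ hm₁ (by positivity) hw₀ hw₂ hm₀ hD23 hS

end Summit.ValiantsHypothesis.ValiantsHypothesis.Theorems.LacunarySymmetroidMatrixDescartes.Pivot.TwoDirections.BlockLaw
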